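import Summits.CriticalPhenomena.PercolationContinuityZ3.Theorems.PercNearOneGluingNoHeavyLowerTailStarSetPairRowLevelTwo
import HarnessLib

/-!
# `NoHeavyLowerTail` (stmt-CriticalPhenomena-4575) — OES at level `j ≤ 2` for every LIGHT two-port star multigraph (unconditional)

Support file (prover `prim-gen-swap` gen 9; `--supports stmt-CriticalPhenomena-4575`).  No definitions, no named facts, no sorries.

The pair-row certificate `StarSet.setCS_twoPortStarMultigraph_pairRow_levelTwo` needs the two supply inequalities G0/G1 (seat memo
MWF-CERT.md §2).  Both hold trivially — with no hair budget at all — as soon as the total pair-row price is at most one: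
`Σ_K Θ_K · Zfar_K ≤ 1`, where `Θ_K = 1 − Π_{cls i = K}(1 − θ_i)` is the weight of the class `K` and `Zfar_K` the product of `1 − Θ_{K'}` over
the classes `K'` sharing no port with `K`.  This gives an observer-extension theorem for ARBITRARY port multigraphs (cycles, parallel
stars) with no structural hypothesis, in the light / mutually damped regime:

* `StarSet.setCS_twoPortStarMultigraph_light_levelTwo` — `Σ_K Θ_K Zfar_K ≤ 1` ⇒ `μ(c ↮ S, 1 ≤ |π(S)| ≤ j) ≤ μ(c ↮ S, |π(c)| ≤ j)`.
(The forest theorems of …StarSetClassForestLevelTwo cover the complementary structured regime with no weight hypothesis; the mixed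
MWF rule of the memo interpolates.)
-/

noncomputable section

namespace Summit.CriticalPhenomena.PercolationContinuityZ3.Theorems

open MeasureTheory Set Literature.Probability.LatticeModels Literature.Probability.Percolation
open scoped Classical BigOperators

variable {n m M : ℕ}

namespace StarSet

/-- **OES at level `j ≤ 2` for every two-port star multigraph with total pair-row price at most one** (see the file header).
[cite: VandenbergHaggstromKahn2005, Thm. 1.5 (p. 7) — the only non-elementary input, via `observerSet_le_of_lonelier`] -/
theorem setCS_twoPortStarMultigraph_light_levelTwo (w : Sym2 (Fin n) → unitInterval) (A : Finset (Fin n)) (s p p' : Fin m → Fin n)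
    (cls : Fin m → Fin M) (P P' : Fin M → Fin n) (hP : ∀ i, p i = P (cls i)) (hP' : ∀ i, p' i = P' (cls i))
    (c : Fin n) (j : ℕ) (hj : j ≤ 2) (hs : Function.Injective s) (hsA : ∀ i, s i ∉ A)
    (hPA : ∀ I, P I ∈ A) (hP'A : ∀ I, P' I ∈ A) (hPP' : ∀ I, P I ≠ P' I)
    (hnopar : ∀ I K : Fin M, I ≠ K → ¬ ((P K = P I ∨ P K = P' I) ∧ (P' K = P I ∨ P' K = P' I)))
    (hcA : c ∈ A) (hcP : ∀ I, c ≠ P I ∧ c ≠ P' I)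
    (hobs : ∀ i u, u ≠ s i → u ≠ p i → u ≠ p' i → w s(s i, u) = 0)
    (hdom : ∀ I,
      (prodBernoulli w).real {ω : BondConfig (Fin n) | (A.filter fun z => ω ∈ openConn (P I) z).card ≤ j} ≤
          (prodBernoulli w).real {ω : BondConfig (Fin n) | (A.filter fun z => ω ∈ openConn c z).card ≤ j} ∧
        (prodBernoulli w).real {ω : BondConfig (Fin n) | (A.filter fun z => ω ∈ openConn (P' I) z).card ≤ j} ≤
          (prodBernoulli w).real {ω : BondConfig (Fin n) | (A.filter fun z => ω ∈ openConn c z).card ≤ j})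
    (hlight : ∑ K, ((1 - ∏ i ∈ Finset.univ.filter (fun i => cls i = K), (1 - (w s(s i, p i) : ℝ) * w s(s i, p' i))) *
        ∏ K' ∈ Finset.univ.filter (fun K' => ¬ (P K' = P K ∨ P K' = P' K ∨ P' K' = P K ∨ P' K' = P' K)),
          ∏ i ∈ Finset.univ.filter (fun i => cls i = K'), (1 - (w s(s i, p i) : ℝ) * w s(s i, p' i))) ≤ 1) :
    (prodBernoulli w).real {ω : BondConfig (Fin n) | (∀ x ∈ Finset.univ.image s, ω ∉ openConn c x) ∧
        1 ≤ (A.filter fun z => ∃ x ∈ Finset.univ.image s, ω ∈ openConn x z).card ∧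
        (A.filter fun z => ∃ x ∈ Finset.univ.image s, ω ∈ openConn x z).card ≤ j} ≤
      (prodBernoulli w).real {ω : BondConfig (Fin n) | (∀ x ∈ Finset.univ.image s, ω ∉ openConn c x) ∧
        (A.filter fun z => ω ∈ openConn c z).card ≤ j} := by
  set θ : Fin m → ℝ := fun i => (w s(s i, p i) : ℝ) * w s(s i, p' i) with hθ
  have hθ0 : ∀ i, 0 ≤ θ i := fun i => mul_nonneg (w _).2.1 (w _).2.1
  have hθ1 : ∀ i, θ i ≤ 1 := fun i => mul_le_one₀ (w _).2.2 (w _).2.1 (w _).2.2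
  set uu : Fin M → ℝ := fun K => ∏ i ∈ Finset.univ.filter (fun i => cls i = K), (1 - θ i) with huu
  have huu0 : ∀ K, 0 ≤ uu K := fun K => Finset.prod_nonneg fun i _ => sub_nonneg.2 (hθ1 i)
  have huu1 : ∀ K, uu K ≤ 1 := fun K => Finset.prod_le_one (fun i _ => sub_nonneg.2 (hθ1 i)) fun i _ => sub_le_self _ (hθ0 i)
  set D : Fin M → ℝ := fun K => (1 - uu K) *
    ∏ K' ∈ Finset.univ.filter (fun K' => ¬ (P K' = P K ∨ P K' = P' K ∨ P' K' = P K ∨ P' K' = P' K)), uu K' with hD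
  have hDnn : ∀ K, 0 ≤ D K := fun K => mul_nonneg (sub_nonneg.2 (huu1 K)) (Finset.prod_nonneg fun K' _ => huu0 K')
  set coef : (Fin m → Fin 3) → ℝ := fun e => ∏ i, (if (w s(s i, p i) : ℝ) * w s(s i, p' i) < 1 then
      ((if e i = 1 then (w s(s i, p i) : ℝ) else 1 - w s(s i, p i)) *
        (if e i = 2 then (w s(s i, p' i) : ℝ) else 1 - w s(s i, p' i))) / (1 - (w s(s i, p i) : ℝ) * w s(s i, p' i))
      else if e i = 1 then 1 else 0) with hcoef
  have hcoefnn : ∀ e, 0 ≤ coef e := fun e => Finset.prod_nonneg fun i _ =>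
    extremeCoeff_nonneg _ _ (w _).2.1 (w _).2.2 (w _).2.1 (w _).2.2 (e i)
  set C0 : ℝ := ∏ i, (if (w s(s i, p i) : ℝ) * w s(s i, p' i) < 1 then
      ((1 - (w s(s i, p i) : ℝ)) * (1 - w s(s i, p' i))) / (1 - (w s(s i, p i) : ℝ) * w s(s i, p' i)) else 0) with hC0
  have hC0nn : 0 ≤ C0 := by
    refine Finset.prod_nonneg fun i _ => ?_
    split_ifs with h
    · exact div_nonneg (mul_nonneg (sub_nonneg.2 (w _).2.2) (sub_nonneg.2 (w _).2.2)) (by linarith)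
    · exact le_refl 0
  set Rw : (Fin m → Fin 3) → Finset (Fin n) := fun e =>
    (Finset.univ.filter fun i => e i = 1).image p ∪ (Finset.univ.filter fun i => e i = 2).image p' with hRw
  have hbnn : ∀ e, 0 ≤ (if 3 ≤ (Rw e).card then coef e else 0) := fun e => by
    split_ifs; exacts [hcoefnn e, le_refl 0]
  refine setCS_twoPortStarMultigraph_pairRow_levelTwo w A s p p' cls P P' hP hP' c j hj hs hsA hPA hP'A hPP' hnopar hcA hcP hobs hdom ?_ ?_
  · -- G0
    change C0 * ∑ K, D K ≤ C0 + ∑ e, (if 3 ≤ (Rw e).card then coef e else 0)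
    have h1 : C0 * ∑ K, D K ≤ C0 := by
      have := mul_le_mul_of_nonneg_left hlight hC0nn
      simpa using this
    have h2 : 0 ≤ ∑ e, (if 3 ≤ (Rw e).card then coef e else 0) := Finset.sum_nonneg fun e _ => hbnn e
    linarith
  · -- G1
    intro r
    change C0 * ∑ K ∈ Finset.univ.filter (fun K => P K ≠ r ∧ P' K ≠ r), D K ≤
      C0 + ∑ e ∈ Finset.univ.filter (fun e => r ∉ Rw e), (if 3 ≤ (Rw e).card then coef e else 0)
    have hsub : ∑ K ∈ Finset.univ.filter (fun K => P K ≠ r ∧ P' K ≠ r), D K ≤ ∑ K, D K :=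
      Finset.sum_le_sum_of_subset_of_nonneg (Finset.filter_subset _ _) fun K _ _ => hDnn K
    have h1 : C0 * ∑ K ∈ Finset.univ.filter (fun K => P K ≠ r ∧ P' K ≠ r), D K ≤ C0 := by
      have := mul_le_mul_of_nonneg_left (hsub.trans hlight) hC0nn
      simpa using this
    have h2 : 0 ≤ ∑ e ∈ Finset.univ.filter (fun e => r ∉ Rw e), (if 3 ≤ (Rw e).card then coef e else 0) :=
      Finset.sum_nonneg fun e _ => hbnn e
    linarith

end StarSet

end Summit.CriticalPhenomena.PercolationContinuityZ3.Theorems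

end
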